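import Mathlib
import HarnessLib
import Summits.ResolutionOfSingularities.ResolutionOfSingularities.Theorems.WildQuotientsWildQuotientResolutionS1aMemberAwayRelations
import Summits.ResolutionOfSingularities.ResolutionOfSingularities.Theorems.WildQuotientsWildQuotientResolutionS1aResidualPointTransport

/-!
# S1a — R4c cusp UNITS brick (b3′-units): a member section with VALUE `s·u^e = P/1` in the localised model is a unit at every point of `D(b)` where a
# producer section of value `P^N · (unit)` is (`memberSection_basicOpen_of_value`)

[OURS · L1 W4.5c · leafhand-res-wildquotients-7 g1] — NOT statements of the manuscript; counted 0; AI-level work, weaker than expert review. Crux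
stmt-ResolutionOfSingularities-17941 `CyclicQuotientFourfolds`, line `s1a-logminvertex` v13 (`stub_reachLowerInFX`), R4c `cusp_killsIn_two` (crux-dir skeleton v2,
`Lines/s1a_logminvertex-R4c-PROGRESS-v2.md`, UNITS obligation (U1)/(U2) of ✓`killsIn_one_of_sectionCharts_of_associated`: "on `U_c ∩ D(z₀)` the generator `a′` is a
unit, on `U_c ∩ D(z₁)` the generator `bb` is").

FINDING (this hand): the cusp member lemmas (✓`exists_cuspO_memberChart_rel_xi`, ✓`exists_cuspQ_memberChart_rel`, ✓`exists_cuspQv_memberChart_rel`) export their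
generators `a′, bb ∈ Γ(U_c)` only through the RELATIONS `a′·(π^*ξ)|³ = (π^*x₀)|`, `bb·(π^*ξ)|² = (π^*f)|`; on the exceptional divisor `E ∩ U_c` both sides vanish
(`π^*ξ = s^{w_ξ}·h`), so the UNITS clauses are NOT derivable from the exports (the brick ✓`mem_basicOpen_of_mul_pow_eq_of_split` needs a degree-0 `S`, which does
not exist on a weighted chart). They ARE derivable from the VALUES `a′·u^{e₀} = x₀′/1`, `bb·u^{e₁} = φ/1` that ✓`exists_memberSections_away₂` exports one level
below. This file is the abstract bridge (context of ✓`memberSection_relation`, abstract node data `DW`, elaborates fast):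
* ★ `memberSection_basicOpen_of_value` — if `(e_{D(b)} s)·u^e = P/1` in `k[s,x′][1/(q b′)]` and a producer section `z ∈ Γ(W)` has chart value
  `Φ(DW.e z) = (P^N/1)·w` with `w` a unit and `N > 0` (the residual sections: `z₀ ↦ x₀′^{n₀}·(1/c)`, `z₁ ↦ φ′ⁿ·(1/c)`), then `D(b) ∩ D(z) ⊆ D(s)`.
  Proof: points of `D(b)` read as primes of the localised model (✓`BlowupCharts.exists_isPrime_forall_mem_basicOpen_iff`, p820250), values of restricted
  sections (✓`NodeChartAway.coe_basicOpenNodeEquiv_map` + the second pin `hpin`).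
So the member lemmas can re-export `D(z₀) ∩ U_c ⊆ D(a′)`, `D(z₁) ∩ U_c ⊆ D(bb)` with two extra lines each (remaining work, see the hand's report).
-/

set_option linter.dupNamespace false

noncomputable section

open CategoryTheory Limits AlgebraicGeometry TopologicalSpace Topology Opposite MvPolynomial
open Literature.AlgebraicGeometry.Resolution Literature.AlgebraicGeometry.RelativeSpec
open scoped LaurentPolynomial
open Summit.ResolutionOfSingularities.ResolutionOfSingularities.Theorems.WildQuotientResolution.S1
open Summit.ResolutionOfSingularities.ResolutionOfSingularities.Theorems.WildQuotientResolution.S1.NodeAtlas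
open Summit.ResolutionOfSingularities.ResolutionOfSingularities.Theorems.WildQuotientResolution.S1.ProducerStep
open Summit.ResolutionOfSingularities.ResolutionOfSingularities.Theorems.WildQuotientResolution.S1.CoarseChart
open Summit.ResolutionOfSingularities.ResolutionOfSingularities.Theorems.WildQuotientResolution.S1.NodeTransport
open Summit.ResolutionOfSingularities.ResolutionOfSingularities.Theorems.WildQuotientResolution.S1.KillCert
open Summit.ResolutionOfSingularities.ResolutionOfSingularities.Theorems.WildQuotientResolution.S1.BlowupCharts
open Summit.ResolutionOfSingularities.ResolutionOfSingularities.Theorems.WildQuotientResolution.S1.NpFrame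
open Summit.ResolutionOfSingularities.ResolutionOfSingularities.Theorems.WildQuotientResolution.S1.NodeAway
open Summit.ResolutionOfSingularities.ResolutionOfSingularities.Theorems.WildQuotientResolution.S1.FreeModel
open Summit.ResolutionOfSingularities.ResolutionOfSingularities.Theorems.WildQuotientResolution.S1.GoodCharts
open Summit.ResolutionOfSingularities.ResolutionOfSingularities.Theorems.WildQuotientResolution.S1.GameFrame.GModel

namespace Summit.ResolutionOfSingularities.ResolutionOfSingularities.Theorems.WildQuotientResolution.S1.GameFrame.GModel

variable {p : ℕ} {X' X₁ : Scheme.{0}} {q : X' ⟶ X₁} {G : Type} [Group G] {ρ : G →* Aut X'} {g₀ : G}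

section MemberAway

variable {k : Type} [Field k] (M : GModel p q G ρ g₀) (W : M.act.StableAffineOpens) (DW : NodeData p M.act g₀ W)
  (qd b' : (MvPolynomial (Option (Fin 4)) k)) (Φ : letI := DW.instCommRing; letI := DW.instGradedRing; DW.B ≃+* Localization.Away qd) (b : Γ(M.V, W.1))
  (Φ' : letI := DW.instCommRing; letI := DW.instGradedRing; (Localization.Away ((DW.e b : ↥(DW.𝒜 0)) : DW.B)) ≃+* Localization.Away (qd * b'))
  (hpin : letI := DW.instCommRing; letI := DW.instGradedRing; ∀ a : (MvPolynomial (Option (Fin 4)) k), Φ' (algebraMap DW.B (Localization.Away ((DW.e b : ↥(DW.𝒜 0)) : DW.B)) (Φ.symm ((algebraMap (MvPolynomial (Option (Fin 4)) k) (Localization.Away qd)) a))) = (algebraMap (MvPolynomial (Option (Fin 4)) k) (Localization.Away (qd * b'))) a)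

set_option maxHeartbeats 4000000 in
set_option synthInstance.maxHeartbeats 400000 in
include hpin in
/-- ★ **A member section is a unit wherever the residual factor of its value is.** In the localised model `k[s,x′][1/(q b′)]` of the member open `D(b)`
of a producer chart `W` (node data `DW`, pinned isos `Φ`, `Φ′` with the pin `hpin`), let `s ∈ Γ(D(b))` have value `(e_{D(b)} s)·u^e = P/1` and let
`z ∈ Γ(W)` have chart value `Φ(DW.e z) = (P^N/1)·w`, `w` a unit, `N > 0`. Then every point of `D(b) ∩ D(z)` lies in `D(s)`. (R4c: `s = a′`, `u = h`, `P = x₀′`,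
`z = z₀` the `x₀`-residual section; `s = bb`, `P = φ′`, `z = z₁` the tail residual section.) [OURS · L1 W4.5c · R4c UNITS (U1)/(U2)] -/
theorem memberSection_basicOpen_of_value
    (s : Γ(M.V, M.V.basicOpen b)) (u P : (MvPolynomial (Option (Fin 4)) k)) (e : ℕ)
    (hs : letI := DW.instCommRing; letI := DW.instGradedRing; letI := GradedLocalization.locGradedRing DW.𝒜 (DW.e b).2; letI := mapGradedRing (GradedLocalization.locPiece DW.𝒜 (DW.e b).2) Φ'
      ((((NodeChartAway.basicOpenNodeEquiv M.act W DW.affine b DW.𝒜 DW.e).trans (zeroRingEquiv (GradedLocalization.locPiece DW.𝒜 (DW.e b).2) Φ')) s : ↥(mapGrading (GradedLocalization.locPiece DW.𝒜 (DW.e b).2) Φ' 0)) : (Localization.Away (qd * b'))) * (algebraMap (MvPolynomial (Option (Fin 4)) k) (Localization.Away (qd * b'))) u ^ e = (algebraMap (MvPolynomial (Option (Fin 4)) k) (Localization.Away (qd * b'))) P)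
    (z : Γ(M.V, W.1)) {N : ℕ} (hN : 0 < N) (w : Localization.Away qd) (hw : IsUnit w)
    (hz : letI := DW.instCommRing; letI := DW.instGradedRing; Φ ((DW.e z : ↥(DW.𝒜 0)) : DW.B) = (algebraMap (MvPolynomial (Option (Fin 4)) k) (Localization.Away qd)) (P ^ N) * w)
    {v : M.V} (hv : v ∈ M.V.basicOpen b) (hvz : v ∈ M.V.basicOpen z) : v ∈ M.V.basicOpen s := by
  letI := DW.instCommRing
  letI := DW.instGradedRing
  letI instL := GradedLocalization.locGradedRing DW.𝒜 (DW.e b).2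
  letI instP := mapGradedRing (GradedLocalization.locPiece DW.𝒜 (DW.e b).2) Φ'
  -- ### the value of `z|_{D(b)}`
  have hx : ((DW.e z : ↥(DW.𝒜 0)) : DW.B) = Φ.symm ((algebraMap (MvPolynomial (Option (Fin 4)) k) (Localization.Away qd)) (P ^ N)) * Φ.symm w :=
    Φ.injective (by rw [map_mul, Φ.apply_symm_apply, Φ.apply_symm_apply]; exact hz)
  have h1 : ((((NodeChartAway.basicOpenNodeEquiv M.act W DW.affine b DW.𝒜 DW.e).trans (zeroRingEquiv (GradedLocalization.locPiece DW.𝒜 (DW.e b).2) Φ')) ((M.V.presheaf.map (homOfLE (M.V.basicOpen_le b)).op).hom z) : ↥(mapGrading (GradedLocalization.locPiece DW.𝒜 (DW.e b).2) Φ' 0)) : (Localization.Away (qd * b'))) =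
      (algebraMap (MvPolynomial (Option (Fin 4)) k) (Localization.Away (qd * b'))) (P ^ N) * Φ' (algebraMap DW.B (Localization.Away ((DW.e b : ↥(DW.𝒜 0)) : DW.B)) (Φ.symm w)) := by
    rw [RingEquiv.trans_apply, coe_zeroRingEquiv]
    change Φ' (((NodeChartAway.basicOpenNodeEquiv M.act W DW.affine b DW.𝒜 DW.e) (algebraMap Γ(M.V, W.1) Γ(M.V, M.V.basicOpen b) z) : ↥((GradedLocalization.locPiece DW.𝒜 (DW.e b).2) 0)) : (Localization.Away ((DW.e b : ↥(DW.𝒜 0)) : DW.B))) = _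
    rw [NodeChartAway.coe_basicOpenNodeEquiv_map, hx, map_mul, map_mul, hpin]
  have hwU : IsUnit (Φ' (algebraMap DW.B (Localization.Away ((DW.e b : ↥(DW.𝒜 0)) : DW.B)) (Φ.symm w))) := ((hw.map Φ.symm).map _).map Φ'
  -- ### points of `D(b)` as primes of the localised model
  obtain ⟨Q, hQ, hiff⟩ := BlowupCharts.exists_isPrime_forall_mem_basicOpen_iff (DW.affine.basicOpen b) (mapGrading (GradedLocalization.locPiece DW.𝒜 (DW.e b).2) Φ') ((NodeChartAway.basicOpenNodeEquiv M.act W DW.affine b DW.𝒜 DW.e).trans (zeroRingEquiv (GradedLocalization.locPiece DW.𝒜 (DW.e b).2) Φ')) hv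
  have hzU : v ∈ M.V.basicOpen ((M.V.presheaf.map (homOfLE (M.V.basicOpen_le b)).op).hom z) := by
    rw [Scheme.basicOpen_res]; exact ⟨hv, hvz⟩
  have hPN : (algebraMap (MvPolynomial (Option (Fin 4)) k) (Localization.Away (qd * b'))) (P ^ N) * Φ' (algebraMap DW.B (Localization.Away ((DW.e b : ↥(DW.𝒜 0)) : DW.B)) (Φ.symm w)) ∉ Q := by
    rw [← h1]; exact (hiff _).mp hzU
  have hP : (algebraMap (MvPolynomial (Option (Fin 4)) k) (Localization.Away (qd * b'))) P ∉ Q := fun hP =>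
    hPN (Q.mul_mem_right _ (by rw [map_pow]; exact Q.pow_mem_of_mem hP N hN))
  refine (hiff s).mpr fun hsQ => hP ?_
  rw [← hs]
  exact Q.mul_mem_right _ hsQ

end MemberAway

end Summit.ResolutionOfSingularities.ResolutionOfSingularities.Theorems.WildQuotientResolution.S1.GameFrame.GModel

end
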